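import Mathlib.MeasureTheory.Integral.Lebesgue.Countable
import Mathlib.MeasureTheory.Integral.Lebesgue.Add
import Mathlib.Analysis.SpecificLimits.Basic
import HarnessLib

/-!
# The shell (conical) reduction of a `∫⁻` over a contracting filtration: `∫_{W₀} f ≤ (1 − θ)⁻¹ ∫_{W₀ ∖ W₁} f`

Topic `MeasureTheory/Integral`; namespace `Literature.MeasureTheory.Integral`.  THEOREMS ONLY (no definition, no instance, no notation, no named
fact, no `sorry`); Mathlib-only imports.  Cell `pub/hodgecm-mathlib`, crux H413 = `stmt-HodgeConjecture-24833` (lane `--supports`); ROAD «HC-D» (holder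
F0P2-p01 (g23), LEAD T14-10), brick (D3e) «GENERIC CONICAL REDUCTION» dealt to F0P2-p02 (g21) 2026-09-02T16:05Z — the engine behind every «shell by shell,
geometric series» estimate of a singular orbital ∕ zeta integral near its cone point (Tate's `∫_{𝒪} |x|^{s−1} dx`, Harish-Chandra's `|D|^{−1∕2}` near a singular
element, the cusp of `U(2,1)`): one abstract inequality, no local field in sight.

THE LEMMA.  `(X, μ)` a measure space, `f ≥ 0` measurable (`ℝ≥0∞`-valued), `W : ℕ → Set X` a DECREASING sequence of measurable sets (the cone `W 0`, its
successive contractions `W (k+1) ⊆ W k`), SHELLS `S k := W k ∖ W (k+1)`.  If the shell integrals CONTRACT, `∫⁻_{S (k+1)} f ≤ θ · ∫⁻_{S k} f` (`θ < 1` not even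
needed for the inequality below, only for its usefulness), and the CORE `⋂ₖ W k` carries no `f`-mass, then
  **`∫⁻_{W 0} f ∂μ ≤ (1 − θ)⁻¹ · ∫⁻_{S 0} f ∂μ`**  (`shell_reduction_le`),
with EQUALITY when the contraction is an equality (`shell_reduction_eq`): `W 0 = (⋃ₖ S k) ⊔ ⋂ₖ W k`, `∫⁻_{S k} f ≤ θ^k ∫⁻_{S 0} f`, `Σₖ θ^k = (1 − θ)⁻¹` in `ℝ≥0∞`.
The MAP form (`shell_reduction_le_of_image`): `T : X → X` sending measurable sets to measurable sets, `T '' W₀ ⊆ W₀`, `W k := T^[k] '' W₀`, contraction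
hypothesis `∀ A ⊆ W₀` measurable, `∫⁻_{T '' A} f ≤ θ · ∫⁻_A f` — then `S (k+1) ⊆ T '' (S k)` gives the shell contraction, and the conclusion reads
`∫⁻_{W₀} f ≤ (1 − θ)⁻¹ · ∫⁻_{W₀ ∖ T '' W₀} f` provided `∫⁻_{⋂ₖ T^[k] '' W₀} f = 0`.

HONEST LABEL: count-neutral generic measure theory; HC_CM is proved only modulo the printed citations (2 remaining named inputs hLiu418 =
`stmt-HodgeConjecture-24832`, h413 = `stmt-HodgeConjecture-24833`) until rung 0 closes.

## References
* [Tate1950] J. Tate, *Fourier analysis in number fields and Hecke's zeta-functions* (1950), §2.4 (absolute convergence of the local zeta integral, shell by shell).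
* [Folland1999] G. B. Folland, *Real Analysis* (2nd ed., 1999), §2.2 Thm. 2.15 (countable additivity of `∫ f dμ` in the set) — the only measure theory used.
-/

set_option autoImplicit false

open MeasureTheory Set Filter
open scoped ENNReal

namespace Literature.MeasureTheory.Integral

variable {X : Type*} [MeasurableSpace X] (μ : Measure X)

/-! ## §1 The filtration form -/

/-- Shells of a decreasing sequence contract geometrically: `∫⁻_{S k} f ≤ θ^k · ∫⁻_{S 0} f` from the one-step contraction. [folklore] -/
private theorem lintegral_shell_le_pow_mul (f : X → ℝ≥0∞) (W : ℕ → Set X) (θ : ℝ≥0∞)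
    (hstep : ∀ k, ∫⁻ x in W (k + 1) \ W (k + 2), f x ∂μ ≤ θ * ∫⁻ x in W k \ W (k + 1), f x ∂μ) (k : ℕ) :
    ∫⁻ x in W k \ W (k + 1), f x ∂μ ≤ θ ^ k * ∫⁻ x in W 0 \ W 1, f x ∂μ := by
  induction k with
  | zero => simp
  | succ k ih =>
    calc ∫⁻ x in W (k + 1) \ W (k + 1 + 1), f x ∂μ ≤ θ * ∫⁻ x in W k \ W (k + 1), f x ∂μ := hstep k
      _ ≤ θ * (θ ^ k * ∫⁻ x in W 0 \ W 1, f x ∂μ) := by gcongr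
      _ = θ ^ (k + 1) * ∫⁻ x in W 0 \ W 1, f x ∂μ := by rw [← mul_assoc, pow_succ']

omit [MeasurableSpace X] in
/-- **A decreasing sequence is its shells plus its core**: `W 0 = (⋃ₖ W k ∖ W (k+1)) ∪ ⋂ₖ W k` (the disjoint decomposition behind countable additivity
along a filtration). [cite: Folland1999, §1.3 Thm. 1.8 (continuity from above, proof)] -/
theorem eq_iUnion_shell_union_iInter (W : ℕ → Set X) (hW : Antitone W) :
    W 0 = (⋃ k, W k \ W (k + 1)) ∪ ⋂ k, W k := by
  ext x
  simp only [mem_union, mem_iUnion, Set.mem_sdiff, mem_iInter]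
  constructor
  · intro hx
    by_cases hall : ∀ k, x ∈ W k
    · exact Or.inr hall
    · push Not at hall
      -- the least `k` with `x ∉ W k` is positive; its predecessor is the shell index
      classical
      have hk : x ∉ W (Nat.find hall) := Nat.find_spec hall
      have hk0 : Nat.find hall ≠ 0 := fun h0 => by rw [h0] at hk; exact hk hx
      obtain ⟨j, hj⟩ := Nat.exists_eq_succ_of_ne_zero hk0
      refine Or.inl ⟨j, ?_, ?_⟩
      · by_contra hxj
        exact Nat.find_min hall (show j < Nat.find hall by omega) hxj
      · rw [hj] at hk; exact hk
  · rintro (⟨k, hk, -⟩ | hall)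
    · exact hW (Nat.zero_le k) hk
    · exact hall 0

/-- **SHELL REDUCTION (inequality).**  `f ≥ 0`, `W` decreasing (no measurability needed), shells contracting by `θ`, core of `f`-mass zero ⇒
`∫⁻_{W 0} f ≤ (1 − θ)⁻¹ · ∫⁻_{W 0 ∖ W 1} f` (`(1 − θ)⁻¹ = Σₖ θ^k` in `ℝ≥0∞`; for `θ ≥ 1` the right side is `∞` unless the shell integral vanishes).
[cite: Tate1950, §2.4] [cite: Folland1999, §2.2 Thm. 2.15] -/
theorem shell_reduction_le (f : X → ℝ≥0∞) (W : ℕ → Set X) (hW : Antitone W) (θ : ℝ≥0∞)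
    (hstep : ∀ k, ∫⁻ x in W (k + 1) \ W (k + 2), f x ∂μ ≤ θ * ∫⁻ x in W k \ W (k + 1), f x ∂μ)
    (hcore : ∫⁻ x in ⋂ k, W k, f x ∂μ = 0) :
    ∫⁻ x in W 0, f x ∂μ ≤ (1 - θ)⁻¹ * ∫⁻ x in W 0 \ W 1, f x ∂μ := by
  calc ∫⁻ x in W 0, f x ∂μ = ∫⁻ x in (⋃ k, W k \ W (k + 1)) ∪ ⋂ k, W k, f x ∂μ := by rw [← eq_iUnion_shell_union_iInter W hW]
    _ ≤ (∫⁻ x in ⋃ k, W k \ W (k + 1), f x ∂μ) + ∫⁻ x in ⋂ k, W k, f x ∂μ := lintegral_union_le _ _ _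
    _ = ∫⁻ x in ⋃ k, W k \ W (k + 1), f x ∂μ := by rw [hcore, add_zero]
    _ ≤ ∑' k, ∫⁻ x in W k \ W (k + 1), f x ∂μ := lintegral_iUnion_le _ _
    _ ≤ ∑' k, θ ^ k * ∫⁻ x in W 0 \ W 1, f x ∂μ := ENNReal.tsum_le_tsum (lintegral_shell_le_pow_mul μ f W θ hstep)
    _ = (1 - θ)⁻¹ * ∫⁻ x in W 0 \ W 1, f x ∂μ := by rw [ENNReal.tsum_mul_right, ENNReal.tsum_geometric]

/-- **SHELL REDUCTION (equality).**  If the shells contract EXACTLY, `∫⁻_{S (k+1)} f = θ · ∫⁻_{S k} f`, and the core carries no `f`-mass, then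
`∫⁻_{W 0} f = (1 − θ)⁻¹ · ∫⁻_{W 0 ∖ W 1} f` (disjoint shells: countable additivity). [cite: Tate1950, §2.4] [cite: Folland1999, §2.2 Thm. 2.15] -/
theorem shell_reduction_eq (f : X → ℝ≥0∞) (W : ℕ → Set X) (hW : Antitone W) (hWm : ∀ k, MeasurableSet (W k)) (θ : ℝ≥0∞)
    (hstep : ∀ k, ∫⁻ x in W (k + 1) \ W (k + 2), f x ∂μ = θ * ∫⁻ x in W k \ W (k + 1), f x ∂μ)
    (hcore : ∫⁻ x in ⋂ k, W k, f x ∂μ = 0) :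
    ∫⁻ x in W 0, f x ∂μ = (1 - θ)⁻¹ * ∫⁻ x in W 0 \ W 1, f x ∂μ := by
  have hpow : ∀ k, ∫⁻ x in W k \ W (k + 1), f x ∂μ = θ ^ k * ∫⁻ x in W 0 \ W 1, f x ∂μ := by
    intro k
    induction k with
    | zero => simp
    | succ k ih => rw [hstep k, ih, ← mul_assoc, pow_succ']
  have hdisj : Pairwise (Function.onFun Disjoint fun k => W k \ W (k + 1)) := by
    intro i j hij
    rcases lt_or_gt_of_ne hij with h | h
    · exact disjoint_left.2 fun x hi hj => hi.2 (hW (Nat.succ_le_of_lt h) hj.1)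
    · exact disjoint_left.2 fun x hi hj => hj.2 (hW (Nat.succ_le_of_lt h) hi.1)
  have hcore' : Disjoint (⋃ k, W k \ W (k + 1)) (⋂ k, W k) :=
    disjoint_left.2 fun x hx hall => by
      obtain ⟨k, hk⟩ := mem_iUnion.1 hx
      exact hk.2 (mem_iInter.1 hall (k + 1))
  calc ∫⁻ x in W 0, f x ∂μ = ∫⁻ x in (⋃ k, W k \ W (k + 1)) ∪ ⋂ k, W k, f x ∂μ := by rw [← eq_iUnion_shell_union_iInter W hW]
    _ = (∫⁻ x in ⋃ k, W k \ W (k + 1), f x ∂μ) + ∫⁻ x in ⋂ k, W k, f x ∂μ :=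
        lintegral_union (MeasurableSet.iInter hWm) hcore'
    _ = ∫⁻ x in ⋃ k, W k \ W (k + 1), f x ∂μ := by rw [hcore, add_zero]
    _ = ∑' k, ∫⁻ x in W k \ W (k + 1), f x ∂μ := lintegral_iUnion (fun k => (hWm k).diff (hWm _)) hdisj _
    _ = ∑' k, θ ^ k * ∫⁻ x in W 0 \ W 1, f x ∂μ := tsum_congr hpow
    _ = (1 - θ)⁻¹ * ∫⁻ x in W 0 \ W 1, f x ∂μ := by rw [ENNReal.tsum_mul_right, ENNReal.tsum_geometric]

/-! ## §2 The map form: `W k = T^[k] '' W₀` -/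

omit [MeasurableSpace X] in
/-- Iterated images of a `T`-stable set decrease: `T^[k+1] '' W₀ ⊆ T^[k] '' W₀` when `T '' W₀ ⊆ W₀`. [folklore] -/
private theorem image_iterate_antitone (T : X → X) (W₀ : Set X) (hT : T '' W₀ ⊆ W₀) : Antitone fun k => T^[k] '' W₀ := by
  refine antitone_nat_of_succ_le fun k => ?_
  rw [Function.iterate_succ, image_comp]
  exact image_mono hT

omit [MeasurableSpace X] in
/-- The `(k+1)`-st shell lies in the image of the `k`-th: `T^[k+1] '' W₀ ∖ T^[k+2] '' W₀ ⊆ T '' (T^[k] '' W₀ ∖ T^[k+1] '' W₀)`. [folklore] -/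
private theorem shell_succ_subset_image (T : X → X) (W₀ : Set X) (k : ℕ) :
    T^[k + 1] '' W₀ \ T^[k + 2] '' W₀ ⊆ T '' (T^[k] '' W₀ \ T^[k + 1] '' W₀) := by
  intro y hy
  rw [Function.iterate_succ', image_comp] at hy
  obtain ⟨x, hx, rfl⟩ := hy.1
  refine ⟨x, ⟨hx, fun hx' => hy.2 ?_⟩, rfl⟩
  rw [Function.iterate_succ', image_comp]
  exact ⟨x, hx', rfl⟩

/-- **SHELL REDUCTION, map form.**  `T : X → X` mapping measurable sets to measurable sets, `W₀` measurable and `T`-stable, `f ≥ 0` measurable; if `T`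
CONTRACTS the `f`-mass of every measurable `A ⊆ W₀` by `θ` (`∫⁻_{T '' A} f ≤ θ · ∫⁻_A f`) and the core `⋂ₖ T^[k] '' W₀` carries no `f`-mass, then
**`∫⁻_{W₀} f ≤ (1 − θ)⁻¹ · ∫⁻_{W₀ ∖ T '' W₀} f`** — the whole cone is controlled by its first shell. [cite: Tate1950, §2.4] [cite: Folland1999, §2.2 Thm. 2.15] -/
theorem shell_reduction_le_of_image (f : X → ℝ≥0∞) (T : X → X) (hTm : ∀ A : Set X, MeasurableSet A → MeasurableSet (T '' A))
    (W₀ : Set X) (hW₀ : MeasurableSet W₀) (hT : T '' W₀ ⊆ W₀) (θ : ℝ≥0∞)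
    (hcontract : ∀ A ⊆ W₀, MeasurableSet A → ∫⁻ x in T '' A, f x ∂μ ≤ θ * ∫⁻ x in A, f x ∂μ)
    (hcore : ∫⁻ x in ⋂ k, T^[k] '' W₀, f x ∂μ = 0) :
    ∫⁻ x in W₀, f x ∂μ ≤ (1 - θ)⁻¹ * ∫⁻ x in W₀ \ T '' W₀, f x ∂μ := by
  have hWm : ∀ k, MeasurableSet (T^[k] '' W₀) := by
    intro k
    induction k with
    | zero => simpa using hW₀
    | succ k ih => rw [Function.iterate_succ', image_comp]; exact hTm _ ih
  have hsub : ∀ k, T^[k] '' W₀ ⊆ W₀ := fun k => by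
    simpa using image_iterate_antitone T W₀ hT (Nat.zero_le k)
  have hstep : ∀ k, ∫⁻ x in T^[k + 1] '' W₀ \ T^[k + 2] '' W₀, f x ∂μ ≤ θ * ∫⁻ x in T^[k] '' W₀ \ T^[k + 1] '' W₀, f x ∂μ := fun k =>
    (lintegral_mono_set (shell_succ_subset_image T W₀ k)).trans
      (hcontract _ (sdiff_subset.trans (hsub k)) ((hWm k).diff (hWm _)))
  have h := shell_reduction_le μ f (fun k => T^[k] '' W₀) (image_iterate_antitone T W₀ hT) θ hstep hcore
  simpa [Function.iterate_one] using h

end Literature.MeasureTheory.Integral
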